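import Mathlib.RingTheory.DualNumber
import Mathlib.RingTheory.Flat.Tensor
import Mathlib.LinearAlgebra.TensorProduct.Quotient
import Literature.RingTheory.Flat.NilpotentCriterion
import HarnessLib

/-!
# Venture HSemireg — flatness over the dual numbers `K[ε]`

The first-order flatness criterion used at every «flat first-order deformation» step of the
computation cell `pub-hsemireg` (CLEAN-FLAT / THEOREM CC / LEMMA F of
`widen/W1/CLEAN-COMPONENT-THEOREM-w1tw1.md` §16): for a field `K` and a module `N` over the dual
numbers `K[ε]`,

  `N` is flat over `K[ε]`  ⟺  every `n ∈ N` with `ε • n = 0` is of the form `ε • m`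

(`Ann_N(ε) = εN`, i.e. `Tor₁^{K[ε]}(K, N) = 0`; equivalently the surjection `N/εN → εN`, `n̄ ↦ εn`, is
injective). Proof: flatness is tested on the ideals of `K[ε]` (`Module.Flat.iff_lTensor_injective'`),
which are `⊥`, `(ε)` and `⊤` (`DualNumber.ideal_trichotomy`); for `(ε)` the injectivity of
`N ⊗ (ε) → N ⊗ K[ε]` is the displayed condition (`⇐`: the Literature lemma
`lTensor_injective_subtype_span_singleton`; `⇒`: flatness applied to the injective map
`K[ε]/(ε) → K[ε]`, `r̄ ↦ rε`, read through `N ⊗ K[ε]/(ε) ≅ N/εN`).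

* `mem_span_eps_iff`, `mul_eps_eq_zero_iff`, `mem_eps_smul_top_iff` — bookkeeping in `K[ε]`;
* `exists_eq_eps_smul_of_flat` — `⇒`;  `flat_of_forall_exists_eq_eps_smul` — `⇐`;
* `flat_iff_forall_exists_eq_eps_smul` — the criterion; `quotient_flat_iff` — its quotient form
  `M ⧸ F` flat iff `(F : ε) = F + εM` (the shape used for embedded first-order deformations).

HONEST FRAMING. Elementary commutative algebra (Matsumura Thm. 22.3 / the local criterion in its
smallest case); Lean index of the cell's LEMMA F («the Fitting ideal of a flat first-order
deformation is flat across points of depth ≥ 1», whose algebraic half is: `K[ε][x]/F` is flat iff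
`(F : ε) = F + (ε)`). No scheme, sheaf, abelian variety or semiregularity map appears here; nothing
here says that HC, HC_CM or HC_AV holds, and nothing here is a new case of anything.
-/

open DualNumber TrivSqZeroExt TensorProduct
open scoped Pointwise

namespace Summit.Ventures.HSemireg

namespace DualNumberFlat

universe u v

variable {K : Type u} [Field K]

/-- In `K[ε]`, `x ∈ (ε)` iff the constant term of `x` vanishes. [folklore] -/
theorem mem_span_eps_iff {x : K[ε]} : x ∈ (Ideal.span {ε} : Ideal K[ε]) ↔ x.fst = 0 := by
  rw [Ideal.mem_span_singleton, fst_eq_zero_iff_eps_dvd]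

/-- In `K[ε]`, `r * ε = 0` iff the constant term of `r` vanishes. [folklore] -/
theorem mul_eps_eq_zero_iff {r : K[ε]} : r * ε = 0 ↔ r.fst = 0 := by
  constructor
  · intro h
    have := congrArg TrivSqZeroExt.snd h
    simpa using this
  · intro h
    ext <;> simp [h]

/-- For `a ∈ (ε)`: `a * ε = 0`. [folklore] -/
theorem mul_eps_eq_zero_of_mem {a : K[ε]} (ha : a ∈ (Ideal.span {ε} : Ideal K[ε])) : a * ε = 0 :=
  mul_eps_eq_zero_iff.mpr (mem_span_eps_iff.mp ha)

variable {N : Type v} [AddCommGroup N] [Module K[ε] N]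

/-- `n ∈ (ε) • N` iff `n = ε • m` for some `m`. [folklore] -/
theorem mem_eps_smul_top_iff {n : N} :
    n ∈ (Ideal.span {ε} : Ideal K[ε]) • (⊤ : Submodule K[ε] N) ↔ ∃ m : N, (ε : K[ε]) • m = n := by
  rw [Submodule.ideal_span_singleton_smul, Submodule.mem_smul_pointwise_iff_exists]
  simp

/-- **Flat ⇒ `Ann_N(ε) ⊆ εN`.** If `N` is flat over `K[ε]` then every `n` with `ε • n = 0` is a
multiple of `ε`: flatness makes `N ⊗ (K[ε]/(ε)) → N ⊗ K[ε]` (induced by the injective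
`r̄ ↦ rε`) injective, and under `N ⊗ K[ε]/(ε) ≅ N/εN`, `N ⊗ K[ε] ≅ N` this map is `n̄ ↦ ε • n`.
[cite: Matsumura1987, §22 Thm. 22.3 (1) ⇒ (3)] -/
theorem exists_eq_eps_smul_of_flat [Module.Flat K[ε] N] {n : N} (hn : (ε : K[ε]) • n = 0) :
    ∃ m : N, (ε : K[ε]) • m = n := by
  classical
  set J : Ideal K[ε] := Ideal.span {ε} with hJ
  -- the injective map `K[ε]/J → K[ε]`, `r̄ ↦ r * ε`
  have hle : J ≤ LinearMap.ker (LinearMap.toSpanSingleton K[ε] K[ε] (ε : K[ε])) := by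
    intro a ha
    rw [LinearMap.mem_ker, LinearMap.toSpanSingleton_apply, smul_eq_mul]
    exact mul_eps_eq_zero_of_mem ha
  let μ : (K[ε] ⧸ J) →ₗ[K[ε]] K[ε] := Submodule.liftQ J (LinearMap.toSpanSingleton K[ε] K[ε] ε) hle
  have hμmk : ∀ r : K[ε], μ (Ideal.Quotient.mk J r) = r * ε := fun r => by
    rw [← Ideal.Quotient.mk_eq_mk]
    change Submodule.liftQ J (LinearMap.toSpanSingleton K[ε] K[ε] ε) hle (Submodule.Quotient.mk r) = _
    rw [Submodule.liftQ_apply, LinearMap.toSpanSingleton_apply, smul_eq_mul]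
  have hμ : Function.Injective μ := by
    rw [← LinearMap.ker_eq_bot, Submodule.eq_bot_iff]
    intro q hq
    obtain ⟨r, rfl⟩ := Ideal.Quotient.mk_surjective q
    rw [LinearMap.mem_ker, hμmk, mul_eps_eq_zero_iff] at hq
    exact Ideal.Quotient.eq_zero_iff_mem.mpr (mem_span_eps_iff.mpr hq)
  -- flatness: `lTensor N μ` is injective
  have hinj : Function.Injective (μ.lTensor N) :=
    Module.Flat.lTensor_preserves_injective_linearMap μ hμ
  -- evaluate on `n ⊗ 1̄`
  have h1 : μ.lTensor N (n ⊗ₜ[K[ε]] Ideal.Quotient.mk J (1 : K[ε])) = 0 := by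
    rw [LinearMap.lTensor_tmul, hμmk, one_mul]
    calc n ⊗ₜ[K[ε]] (ε : K[ε]) = n ⊗ₜ[K[ε]] ((ε : K[ε]) • (1 : K[ε])) := by rw [smul_eq_mul, mul_one]
      _ = ((ε : K[ε]) • n) ⊗ₜ[K[ε]] (1 : K[ε]) := by rw [tmul_smul, smul_tmul']
      _ = 0 := by rw [hn, zero_tmul]
  have h0 : n ⊗ₜ[K[ε]] Ideal.Quotient.mk J (1 : K[ε]) = (0 : N ⊗[K[ε]] (K[ε] ⧸ J)) :=
    hinj (by rw [h1, map_zero])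
  -- read through `N ⊗ K[ε]/J ≅ N / J • N`
  have hmk : (Submodule.Quotient.mk n : N ⧸ (J • ⊤ : Submodule K[ε] N)) = 0 := by
    have := congrArg (TensorProduct.tensorQuotEquivQuotSMul N J) h0
    rw [map_zero, TensorProduct.tensorQuotEquivQuotSMul_tmul_mk, one_smul] at this
    exact this
  rw [Submodule.Quotient.mk_eq_zero] at hmk
  exact mem_eps_smul_top_iff.mp hmk

/-- **`Ann_N(ε) ⊆ εN` ⇒ flat.** If every `n` with `ε • n = 0` is a multiple of `ε` then `N` is flat
over `K[ε]`: by `Module.Flat.iff_lTensor_injective'` it suffices to test the three ideals `⊥`, `(ε)`,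
`⊤` of `K[ε]`; `⊥` and `⊤` are trivial and `(ε)` is the Literature lemma
`lTensor_injective_subtype_span_singleton` (with `I = (ε)`, which kills `ε`).
[cite: Matsumura1987, §22 Thm. 22.3 (3) ⇒ (1)] -/
theorem flat_of_forall_exists_eq_eps_smul
    (h : ∀ n : N, (ε : K[ε]) • n = 0 → ∃ m : N, (ε : K[ε]) • m = n) : Module.Flat K[ε] N := by
  rw [Module.Flat.iff_lTensor_injective']
  intro I
  rcases ideal_trichotomy I with rfl | rfl | rfl
  · -- `⊥`: the source `N ⊗ ⊥` is zero
    intro x y _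
    have hz : ∀ t : N ⊗[K[ε]] (⊥ : Ideal K[ε]), t = 0 := by
      intro t
      induction t using TensorProduct.induction_on with
      | zero => rfl
      | tmul a b =>
        have hb : b = 0 := Subsingleton.elim _ _
        rw [hb, tmul_zero]
      | add a b ha hb => rw [ha, hb, add_zero]
    rw [hz x, hz y]
  · -- `(ε)`
    exact Literature.RingTheory.Flat.lTensor_injective_subtype_span_singleton (Ideal.span {ε})
      (fun a ha => mul_eps_eq_zero_of_mem ha) (fun n hn => mem_eps_smul_top_iff.mpr (h n hn))
  · -- `⊤`: `⊤.subtype` is an isomorphism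
    have : (⊤ : Submodule K[ε] K[ε]).subtype = (Submodule.topEquiv : (⊤ : Submodule K[ε] K[ε]) ≃ₗ[K[ε]] K[ε]).toLinearMap := rfl
    rw [this]
    exact (LinearEquiv.lTensor N Submodule.topEquiv).injective

/-- **Flatness over the dual numbers.** For a field `K` and a `K[ε]`-module `N`:
`N` is flat over `K[ε]` iff every `n ∈ N` with `ε • n = 0` is of the form `ε • m`
(`Ann_N(ε) = εN`, `Tor₁^{K[ε]}(K, N) = 0`). [cite: Matsumura1987, §22 Thm. 22.3] -/
theorem flat_iff_forall_exists_eq_eps_smul :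
    Module.Flat K[ε] N ↔ ∀ n : N, (ε : K[ε]) • n = 0 → ∃ m : N, (ε : K[ε]) • m = n :=
  ⟨fun _ _ hn => exists_eq_eps_smul_of_flat hn, flat_of_forall_exists_eq_eps_smul⟩

/-- **Quotients: the shape used for embedded first-order deformations.** For a `K[ε]`-module `M`
and a submodule `F`, the quotient `M ⧸ F` is flat over `K[ε]` iff every `m` with `ε • m ∈ F` lies in
`F + εM` («`(F : ε) = F + εM`»). With `M = O_U[ε]` and `F` an ideal this is the flatness test for the
closed subscheme `V(F)` of the trivial first-order deformation of `U` (LEMMA F of the cell record).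
[cite: Matsumura1987, §22 Thm. 22.3] -/
theorem quotient_flat_iff {M : Type v} [AddCommGroup M] [Module K[ε] M] (F : Submodule K[ε] M) :
    Module.Flat K[ε] (M ⧸ F) ↔ ∀ m : M, (ε : K[ε]) • m ∈ F → ∃ m' : M, m - (ε : K[ε]) • m' ∈ F := by
  rw [flat_iff_forall_exists_eq_eps_smul]
  constructor
  · intro h m hm
    obtain ⟨q, hq⟩ := h (Submodule.Quotient.mk m)
      (by rw [← Submodule.Quotient.mk_smul, Submodule.Quotient.mk_eq_zero]; exact hm)
    obtain ⟨m', rfl⟩ := Submodule.Quotient.mk_surjective F q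
    refine ⟨m', ?_⟩
    rw [← Submodule.Quotient.mk_smul, eq_comm, Submodule.Quotient.eq] at hq
    exact hq
  · intro h q hq
    obtain ⟨m, rfl⟩ := Submodule.Quotient.mk_surjective F q
    rw [← Submodule.Quotient.mk_smul, Submodule.Quotient.mk_eq_zero] at hq
    obtain ⟨m', hm'⟩ := h m hq
    refine ⟨Submodule.Quotient.mk m', ?_⟩
    rw [← Submodule.Quotient.mk_smul, eq_comm, Submodule.Quotient.eq]
    exact hm'

end DualNumberFlat

end Summit.Ventures.HSemireg
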